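import Summits.MatrixMultiplication.MatrixMultiplication.Theses.IntegralSignedBoxes

/-!
# Route `IntegralSignedBoxes` — item `LocalToGlobal` (stmt-MatrixMultiplication-18952): the local–global glue of the split of `IntegralExponentTwo`

Item `stmt-MatrixMultiplication-5440` (`IntegralExponentTwo`, "ω(ℤ) = 2": for every `ε > 0` some
`⟨n,n,n⟩`, `n ≥ 2`, is a sum of at most `n^{2+ε}` triads with INTEGER vectors) is the deciding crux of
route `route-MatrixMultiplication-IntegralSignedBoxes`; it is at least as strong as the summit
statement `ω(ℂ) = 2`.  This file PROVES the assembly of its typed decomposition into two pieces,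
each strictly weaker than `IntegralExponentTwo` and neither known to imply `ω(ℂ) = 2`:

* `ModularExponentTwo` — **residue fields**: for every prime `p`, `ω(𝔽_p) = 2` in rank form
  (`∀ ε > 0 ∃ n ≥ 2, R_{𝔽_p}(⟨n,n,n⟩) ≤ n^{2+ε}`, `𝔽_p = ZMod p`);
* `PadicLifting` — **p-adic lifting at the exponent level**, `ω(ℤ_(p)) ≤ ω(𝔽_p)` for every prime
  `p`: if `ω(𝔽_p) ≤ τ` (rank form) then for every `ε > 0` there are `n ≥ 2` and a denominator `D`
  PRIME TO `p` with `R_ℤ(D · ⟨n,n,n⟩) ≤ n^{τ+ε}` (a scheme over `ℤ[1/D] ⊆ ℤ_(p)`; the smeared tensor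
  `D • ⟨n,n,n⟩` over `ℤ` encodes the denominators).

`IntegralExponentTwo_of_subs : ModularExponentTwo → PadicLifting → IntegralExponentTwo` (hypotheses
written out verbatim) and `localToGlobal_proof : IntegralSignedBoxes.LocalToGlobal` (the route item
stmt-MatrixMultiplication-18952, rev 2, literally `ModularExponentTwo → PadicLifting → IntegralExponentTwo`;
closed by defeq).  The proof is the LOCAL–GLOBAL PRINCIPLE for the integral exponent
(Pan 1984, §5: `ω_ℚ ≤ ω_F ≤ ω_ℤ`, open problems (i) `ω_ℚ = ω_ℤ`, (ii) `ω_ℤ = ω_{ℤ/p}`):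

1. at every prime `p` the two pieces give `n_p ≥ 2` and `D_p` with `p ∤ D_p` and
   `R_ℤ(D_p · ⟨n_p⟩) ≤ n_p^{2+δ}` (`δ = ε/4`);
2. INTERPOLATION (`exists_pow_smul_rank_le`): Kronecker powers of the smeared tensor
   (`(D·⟨n⟩)^{⊗S} = D^S · ⟨n^S⟩`, `tensorRank_smul_matMulTensor_pow_le`) and zero-padding
   (`tensorRank_smul_matMulTensor_mono`) give, for EVERY size `m ≥ 1`, some `j` with
   `R_ℤ(D_p^j · ⟨m⟩) ≤ n_p^{2+δ} · m^{2+δ}`;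
3. BEZOUT GLUING (`tensorRank_le_glue_primeFactors`): start from the prime `2`; the bad primes are
   the prime factors `q` of `D_2`; peel them off one at a time — with `D = q^e · D'`, `q ∤ D'`, and
   the local datum `E = D_q^{j'}`, `q ∤ E`, the integers `q^{ej}` and `E` are coprime, so
   `R(D'^j · t) ≤ R(q^{ej} D'^j · t) + R(E · D'^j · t) ≤ R(D^j · t) + R(E · t)`
   (`tensorRank_le_of_isCoprime`: `1 = x a + y b ⇒ t = x(a t) + y(b t)`); induction on the finite set
   of bad primes gives `R_ℤ(⟨m⟩) ≤ (n_2^{2+δ} + ∑_q n_q^{2+δ}) · m^{2+δ}` for all `m`;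
4. absorb the constant: `m^{3ε/4} ≥ C` for `m` large, so `R_ℤ(⟨m,m,m⟩) ≤ m^{2+ε}`.

All rank lemmas are over `ℤ` on finite index types and use only the tree's `tensorRank` toolkit
(`exists_triad_decomposition_tensorRank`, `tensorRank_precomp_le`, `tensorRank_reindex`,
`Blaser2013_lemma58`, `kroneckerTensor_matMulTensor`, `matMulTensor_eq_precomp_castLE`).

References: V. Pan, *How to Multiply Matrices Faster*, LNCS 179 (1984), §5 (ω over a commutative
ring of constants; Thm 5.5, Cor 5.6, problems (i), (ii)) [Pan1984]; P. Bürgisser, M. Clausen,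
M. A. Shokrollahi, *Algebraic Complexity Theory* (1997), §15.3, (15.16) [BurgisserClausenShokrollahi1997];
M. Bläser, *Fast Matrix Multiplication* (2013), Lemma 5.4, 5.8, Thm 5.9 [Blaser2013].
-/

-- single-conjunct summit: the mandated namespace repeats `MatrixMultiplication`.
set_option linter.dupNamespace false

noncomputable section

open scoped BigOperators

namespace Summit.MatrixMultiplication.MatrixMultiplication.Theorems

open Literature.Computability.AlgebraicComplexity
open Summit.MatrixMultiplication.MatrixMultiplication.Theses.IntegralSignedBoxes

/-! ## Rank toolkit over `ℤ` (scaling, sums, Bezout gluing) -/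

section Toolkit

variable {ι κ μ : Type*} [Fintype ι] [Fintype κ] [Fintype μ]

/-- Scaling does not increase the rank: `R(c · t) ≤ R(t)` (scale the first vector of each triad). -/
theorem tensorRank_zsmul_le (c : ℤ) (t : ι → κ → μ → ℤ) : tensorRank (c • t) ≤ tensorRank t := by
  obtain ⟨w, u, v, h⟩ := exists_triad_decomposition_tensorRank t
  refine tensorRank_le_of_eq_sum (fun i a => c * w i a) u v ?_
  funext x y z
  rw [Pi.smul_apply, Pi.smul_apply, Pi.smul_apply, smul_eq_mul, sum_triad_apply]
  conv_lhs => rw [h]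
  rw [sum_triad_apply, Finset.mul_sum]
  exact Finset.sum_congr rfl fun i _ => by ring

/-- Subadditivity: `R(s + t) ≤ R(s) + R(t)` (concatenate two decompositions). -/
theorem tensorRank_add_le' (s t : ι → κ → μ → ℤ) :
    tensorRank (s + t) ≤ tensorRank s + tensorRank t := by
  obtain ⟨w, u, v, hs⟩ := exists_triad_decomposition_tensorRank s
  obtain ⟨w', u', v', ht⟩ := exists_triad_decomposition_tensorRank t
  have hcard : Fintype.card (Fin (tensorRank s) ⊕ Fin (tensorRank t)) =
      tensorRank s + tensorRank t := by simp
  rw [← hcard]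
  refine tensorRank_le_card_of_eq_sum (Sum.elim w w') (Sum.elim u u') (Sum.elim v v') ?_
  rw [Fintype.sum_sum_type]
  simp only [Sum.elim_inl, Sum.elim_inr]
  rw [← hs, ← ht]

/-- **Bezout gluing**: for coprime integers `a, b`, `R(t) ≤ R(a · t) + R(b · t)` — write
`1 = x a + y b`, so `t = x (a t) + y (b t)`. -/
theorem tensorRank_le_of_isCoprime {a b : ℤ} (hab : IsCoprime a b) (t : ι → κ → μ → ℤ) :
    tensorRank t ≤ tensorRank (a • t) + tensorRank (b • t) := by
  obtain ⟨x, y, hxy⟩ := hab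
  have ht : t = x • (a • t) + y • (b • t) := by
    funext i j k
    simp only [Pi.add_apply, Pi.smul_apply, smul_eq_mul]
    linear_combination (-(t i j k)) * hxy
  calc tensorRank t = tensorRank (x • (a • t) + y • (b • t)) := by rw [← ht]
    _ ≤ tensorRank (x • (a • t)) + tensorRank (y • (b • t)) := tensorRank_add_le' _ _
    _ ≤ tensorRank (a • t) + tensorRank (b • t) :=
        Nat.add_le_add (tensorRank_zsmul_le _ _) (tensorRank_zsmul_le _ _)

/-- **Gluing over the bad primes** (induction on a finite set of primes `s` containing the prime
factors of the denominator `D`): if `R(D^j · t) ≤ b` and every `q ∈ s` has a local datum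
`E` with `q ∤ E` and `R(E^{j'} · t) ≤ c q`, then `R(t) ≤ b + ∑_{q ∈ s} c q`. -/
theorem tensorRank_le_glue_primeFactors (t : ι → κ → μ → ℤ) (c : ℕ → ℝ) :
    ∀ (s : Finset ℕ) (D j : ℕ) (b : ℝ), D ≠ 0 → D.primeFactors ⊆ s →
      (∀ q ∈ s, q.Prime ∧ ∃ E : ℕ, ¬ q ∣ E ∧ ∃ j' : ℕ,
        (tensorRank (((E : ℤ) ^ j') • t) : ℝ) ≤ c q) →
      (tensorRank (((D : ℤ) ^ j) • t) : ℝ) ≤ b →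
      (tensorRank t : ℝ) ≤ b + ∑ q ∈ s, c q := by
  intro s
  induction s using Finset.induction_on with
  | empty =>
    intro D j b hD hsub _ hb
    have hD1 : D = 1 := by
      have h0 : D.primeFactors = ∅ := Finset.subset_empty.mp hsub
      rcases Nat.primeFactors_eq_empty.mp h0 with h | h
      · exact absurd h hD
      · exact h
    subst hD1
    have h1 : ((((1 : ℕ) : ℤ)) ^ j) • t = t := by
      funext i k l
      simp
    rw [h1] at hb
    simpa using hb
  | @insert q s hq ih =>
    intro D j b hD hsub hyp hb
    obtain ⟨hqp, E, hE, j', hEj⟩ := hyp q (Finset.mem_insert_self q s)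
    set e : ℕ := D.factorization q with he
    set D' : ℕ := D / q ^ e with hD'
    have hDD' : q ^ e * D' = D := Nat.ordProj_mul_ordCompl_eq_self D q
    have hqD' : ¬ q ∣ D' := Nat.not_dvd_ordCompl hqp hD
    have hD'0 : D' ≠ 0 := (Nat.ordCompl_pos q hD).ne'
    have hsub' : D'.primeFactors ⊆ s := by
      intro r hr
      have hr' := Nat.mem_primeFactors.mp hr
      have hrD : r ∈ D.primeFactors :=
        Nat.mem_primeFactors.mpr ⟨hr'.1, hr'.2.1.trans (Nat.ordCompl_dvd D q), hD⟩
      have hne : r ≠ q := fun h => hqD' (h ▸ hr'.2.1)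
      exact Finset.mem_of_mem_insert_of_ne (hsub hrD) hne
    have hcop : IsCoprime (((q : ℤ) ^ e) ^ j) ((E : ℤ) ^ j') := by
      have h1 : IsCoprime (q : ℤ) (E : ℤ) :=
        Nat.isCoprime_iff_coprime.mpr ((Nat.Prime.coprime_iff_not_dvd hqp).mpr hE)
      exact IsCoprime.pow (IsCoprime.pow_left h1)
    have hcast : ((D : ℤ)) = (q : ℤ) ^ e * (D' : ℤ) := by exact_mod_cast hDD'.symm
    have h1 : ((q : ℤ) ^ e) ^ j • (((D' : ℤ) ^ j) • t) = ((D : ℤ) ^ j) • t := by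
      funext i k l
      simp only [Pi.smul_apply, smul_eq_mul]
      rw [hcast]
      ring
    have h2 : (E : ℤ) ^ j' • (((D' : ℤ) ^ j) • t) = ((D' : ℤ) ^ j) • (((E : ℤ) ^ j') • t) := by
      funext i k l
      simp only [Pi.smul_apply, smul_eq_mul]
      ring
    have hstep : (tensorRank (((D' : ℤ) ^ j) • t) : ℝ) ≤ b + c q := by
      have hg := tensorRank_le_of_isCoprime hcop (((D' : ℤ) ^ j) • t)
      rw [h1, h2] at hg
      have h3 : tensorRank (((D' : ℤ) ^ j) • (((E : ℤ) ^ j') • t)) ≤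
          tensorRank (((E : ℤ) ^ j') • t) := tensorRank_zsmul_le _ _
      have hg' : (tensorRank (((D' : ℤ) ^ j) • t) : ℝ) ≤
          (tensorRank (((D : ℤ) ^ j) • t) : ℝ) + (tensorRank (((E : ℤ) ^ j') • t) : ℝ) := by
        exact_mod_cast hg.trans (Nat.add_le_add_left h3 _)
      linarith
    have hih := ih D' j (b + c q) hD'0 hsub'
      (fun r hr => hyp r (Finset.mem_insert_of_mem hr)) hstep
    rw [Finset.sum_insert hq]
    linarith

end Toolkit

/-! ## Smeared matrix multiplication tensors `D · ⟨n,n,n⟩` over `ℤ`: Kronecker powers, padding -/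

/-- `R((cd) · ⟨kk', mm', nn'⟩) ≤ R(c · ⟨k,m,n⟩) · R(d · ⟨k',m',n'⟩)` — Bläser's Lemma 5.8 with the
identity `⟨k,m,n⟩ ⊗ ⟨k',m',n'⟩ = ⟨kk',mm',nn'⟩`, scalars riding along. -/
theorem tensorRank_smul_matMulTensor_mul_le (c d : ℤ) (k m n k' m' n' : ℕ) :
    tensorRank ((c * d) • matMulTensor ℤ (k * k') (m * m') (n * n')) ≤
      tensorRank (c • matMulTensor ℤ k m n) * tensorRank (d • matMulTensor ℤ k' m' n') := by
  have h := tensorRank_reindex (doubleIndexEquiv k n k' n') (doubleIndexEquiv k m k' m')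
    (doubleIndexEquiv m n m' n') ((c * d) • matMulTensor ℤ (k * k') (m * m') (n * n'))
  rw [← h]
  have heq : (fun a b x => ((c * d) • matMulTensor ℤ (k * k') (m * m') (n * n'))
      (doubleIndexEquiv k n k' n' a) (doubleIndexEquiv k m k' m' b) (doubleIndexEquiv m n m' n' x)) =
      kroneckerTensor (c • matMulTensor ℤ k m n) (d • matMulTensor ℤ k' m' n') := by
    funext a b x
    rw [kroneckerTensor_apply, Pi.smul_apply, Pi.smul_apply, Pi.smul_apply,
      ← kroneckerTensor_matMulTensor, kroneckerTensor_apply]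
    simp only [Pi.smul_apply, smul_eq_mul]
    ring
  rw [heq]
  exact Blaser2013_lemma58 _ _

/-- Kronecker powers of a smeared tensor: `R(D^i · ⟨N^i⟩) ≤ R(D · ⟨N⟩)^i`. -/
theorem tensorRank_smul_matMulTensor_pow_le (D : ℤ) (N i : ℕ) :
    tensorRank ((D ^ i) • matMulTensor ℤ (N ^ i) (N ^ i) (N ^ i)) ≤
      tensorRank (D • matMulTensor ℤ N N N) ^ i := by
  induction i with
  | zero =>
    have h1 : ((D ^ 0) • matMulTensor ℤ (N ^ 0) (N ^ 0) (N ^ 0)) =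
        matMulTensor ℤ (N ^ 0) (N ^ 0) (N ^ 0) := by
      funext a b x
      simp only [Pi.smul_apply, smul_eq_mul, pow_zero, one_mul]
    rw [h1, pow_zero (tensorRank (D • matMulTensor ℤ N N N))]
    exact (tensorRank_matMulTensor_le ℤ _ _ _).trans (by simp)
  | succ i ih =>
    rw [pow_succ, pow_succ, pow_succ]
    exact (tensorRank_smul_matMulTensor_mul_le (D ^ i) D (N ^ i) (N ^ i) (N ^ i) N N N).trans
      (Nat.mul_le_mul_right _ ih)

/-- Zero-padding a smeared tensor: `n ≤ m → R(D · ⟨n⟩) ≤ R(D · ⟨m⟩)`. -/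
theorem tensorRank_smul_matMulTensor_mono (D : ℤ) {n m : ℕ} (h : n ≤ m) :
    tensorRank (D • matMulTensor ℤ n n n) ≤ tensorRank (D • matMulTensor ℤ m m m) := by
  have heq : D • matMulTensor ℤ n n n = fun a b x => (D • matMulTensor ℤ m m m)
      (Prod.map (Fin.castLE h) (Fin.castLE h) a) (Prod.map (Fin.castLE h) (Fin.castLE h) b)
      (Prod.map (Fin.castLE h) (Fin.castLE h) x) := by
    rw [matMulTensor_eq_precomp_castLE ℤ h]
    rfl
  rw [heq]
  exact tensorRank_precomp_le _ _ _ _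

/-- **Interpolation**: one smeared scheme `R(D · ⟨n⟩) ≤ n^τ` (`n ≥ 2`, `τ ≥ 0`) gives schemes at every
size, `R(D^j · ⟨m⟩) ≤ n^τ · m^τ` for some `j` (take `n^{S-1} ≤ m < n^S`, pad to `n^S`, use the
`S`-th Kronecker power). -/
theorem exists_pow_smul_rank_le {n : ℕ} (hn : 2 ≤ n) (D : ℤ) {τ : ℝ} (hτ : 0 ≤ τ)
    (h : (tensorRank (D • matMulTensor ℤ n n n) : ℝ) ≤ (n : ℝ) ^ τ) (m : ℕ) (hm : 1 ≤ m) :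
    ∃ j : ℕ, (tensorRank ((D ^ j) • matMulTensor ℤ m m m) : ℝ) ≤ (n : ℝ) ^ τ * (m : ℝ) ^ τ := by
  have hn1 : 1 < n := hn
  set S : ℕ := Nat.log n m + 1 with hS
  have hlt : m < n ^ S := Nat.lt_pow_succ_log_self hn1 m
  have hle : n ^ S ≤ n * m := by
    rw [hS, pow_succ, mul_comm]
    exact Nat.mul_le_mul_left n (Nat.pow_log_le_self n (by omega))
  refine ⟨S, ?_⟩
  have hnat : tensorRank ((D ^ S) • matMulTensor ℤ m m m) ≤
      tensorRank (D • matMulTensor ℤ n n n) ^ S :=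
    (tensorRank_smul_matMulTensor_mono (D ^ S) hlt.le).trans
      (tensorRank_smul_matMulTensor_pow_le D n S)
  have hn0 : (0 : ℝ) ≤ n := Nat.cast_nonneg _
  have hq0 : (0 : ℝ) ≤ (tensorRank (D • matMulTensor ℤ n n n) : ℝ) := Nat.cast_nonneg _
  calc (tensorRank ((D ^ S) • matMulTensor ℤ m m m) : ℝ)
        ≤ (tensorRank (D • matMulTensor ℤ n n n) : ℝ) ^ S := by exact_mod_cast hnat
    _ ≤ ((n : ℝ) ^ τ) ^ S := pow_le_pow_left₀ hq0 h S
    _ = (((n ^ S : ℕ)) : ℝ) ^ τ := by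
        rw [Nat.cast_pow, ← Real.rpow_natCast, ← Real.rpow_natCast, ← Real.rpow_mul hn0,
          mul_comm, Real.rpow_mul hn0]
    _ ≤ ((n * m : ℕ) : ℝ) ^ τ := Real.rpow_le_rpow (Nat.cast_nonneg _) (by exact_mod_cast hle) hτ
    _ = (n : ℝ) ^ τ * (m : ℝ) ^ τ := by rw [Nat.cast_mul, Real.mul_rpow hn0 (Nat.cast_nonneg _)]

/-! ## The assembly: residue fields + p-adic lifting ⇒ `ω(ℤ) = 2` -/

/-- **Local–global assembly of the split of `IntegralExponentTwo`**:
`ModularExponentTwo → PadicLifting → IntegralExponentTwo` — if `ω(𝔽_p) = 2` for every prime `p`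
(rank form) and p-adic lifting holds at the exponent level (`ω(𝔽_p) ≤ τ ⇒` schemes for `⟨n,n,n⟩`
with denominators prime to `p` and `≤ n^{τ+ε}` terms), then `ω(ℤ) = 2`: Bezout gluing over the
finitely many bad primes of one 2-integral scheme, after interpolating every local scheme to all
sizes.  The two hypotheses are, verbatim, the route items `ModularExponentTwo` and `PadicLifting`
of `IntegralSignedBoxes` (installed by the split of `IntegralExponentTwo`). -/
theorem IntegralExponentTwo_of_subs
    (h₁ : ∀ p : ℕ, p.Prime → ∀ ε : ℝ, 0 < ε → ∃ n : ℕ, 2 ≤ n ∧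
      (Literature.Computability.AlgebraicComplexity.tensorRank
        (Literature.Computability.AlgebraicComplexity.matMulTensor (ZMod p) n n n) : ℝ) ≤
        (n : ℝ) ^ (2 + ε))
    (h₂ : ∀ p : ℕ, p.Prime → ∀ τ : ℝ,
      (∀ ε : ℝ, 0 < ε → ∃ n : ℕ, 2 ≤ n ∧
        (Literature.Computability.AlgebraicComplexity.tensorRank
          (Literature.Computability.AlgebraicComplexity.matMulTensor (ZMod p) n n n) : ℝ) ≤
          (n : ℝ) ^ (τ + ε)) →
      ∀ ε : ℝ, 0 < ε → ∃ n : ℕ, 2 ≤ n ∧ ∃ D : ℕ, ¬ p ∣ D ∧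
        (Literature.Computability.AlgebraicComplexity.tensorRank
          ((D : ℤ) • Literature.Computability.AlgebraicComplexity.matMulTensor ℤ n n n) : ℝ) ≤
          (n : ℝ) ^ (τ + ε)) :
    IntegralExponentTwo := by
  intro ε hε
  set δ : ℝ := ε / 4 with hδ
  have hδ0 : 0 < δ := by positivity
  have h2δ : (0 : ℝ) ≤ 2 + δ := by positivity
  -- Step 1–2: local data at every prime, interpolated to every size.
  have key : ∀ p : ℕ, p.Prime → ∃ n D : ℕ, 2 ≤ n ∧ ¬ p ∣ D ∧ ∀ m : ℕ, 1 ≤ m →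
      ∃ j : ℕ, (tensorRank (((D : ℤ) ^ j) • matMulTensor ℤ m m m) : ℝ) ≤
        (n : ℝ) ^ (2 + δ) * (m : ℝ) ^ (2 + δ) := by
    intro p hp
    obtain ⟨n, hn, D, hD, hb⟩ := h₂ p hp 2 (h₁ p hp) δ hδ0
    exact ⟨n, D, hn, hD, fun m hm => exists_pow_smul_rank_le hn (D : ℤ) h2δ hb m hm⟩
  choose! nf Df hnf hDf hkey using key
  -- Step 3: the base prime 2, its bad primes, and the glued constant.
  set B : Finset ℕ := (Df 2).primeFactors with hB
  set C : ℕ → ℝ := fun p => (nf p : ℝ) ^ (2 + δ) with hC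
  set Ctot : ℝ := C 2 + ∑ q ∈ B, C q with hCtot
  have hCnn : ∀ p, 0 ≤ C p := fun p => Real.rpow_nonneg (Nat.cast_nonneg _) _
  have hCtot0 : 0 ≤ Ctot := add_nonneg (hCnn 2) (Finset.sum_nonneg fun q _ => hCnn q)
  have hD20 : Df 2 ≠ 0 := fun h => hDf 2 Nat.prime_two (h ▸ dvd_zero 2)
  have glued : ∀ m : ℕ, 1 ≤ m →
      (tensorRank (matMulTensor ℤ m m m) : ℝ) ≤ Ctot * (m : ℝ) ^ (2 + δ) := by
    intro m hm
    obtain ⟨j, hj⟩ := hkey 2 Nat.prime_two m hm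
    have hyp : ∀ q ∈ B, q.Prime ∧ ∃ E : ℕ, ¬ q ∣ E ∧ ∃ j' : ℕ,
        (tensorRank (((E : ℤ) ^ j') • matMulTensor ℤ m m m) : ℝ) ≤ C q * (m : ℝ) ^ (2 + δ) := by
      intro q hq
      have hqp : q.Prime := Nat.prime_of_mem_primeFactors hq
      obtain ⟨j', hj'⟩ := hkey q hqp m hm
      exact ⟨hqp, Df q, hDf q hqp, j', hj'⟩
    have hglue := tensorRank_le_glue_primeFactors (matMulTensor ℤ m m m)
      (fun q => C q * (m : ℝ) ^ (2 + δ)) B (Df 2) j (C 2 * (m : ℝ) ^ (2 + δ)) hD20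
      (Finset.Subset.refl _) hyp hj
    calc (tensorRank (matMulTensor ℤ m m m) : ℝ)
          ≤ C 2 * (m : ℝ) ^ (2 + δ) + ∑ q ∈ B, C q * (m : ℝ) ^ (2 + δ) := hglue
      _ = Ctot * (m : ℝ) ^ (2 + δ) := by rw [hCtot, add_mul, Finset.sum_mul]
  -- Step 4: absorb the constant.
  set γ : ℝ := 3 * ε / 4 with hγ
  have hγ0 : 0 < γ := by positivity
  obtain ⟨m, hm2, hmC⟩ : ∃ m : ℕ, 2 ≤ m ∧ Ctot ≤ (m : ℝ) ^ γ := by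
    refine ⟨⌈Ctot ^ γ⁻¹⌉₊ + 2, by omega, ?_⟩
    have h0 : 0 ≤ Ctot ^ γ⁻¹ := Real.rpow_nonneg hCtot0 _
    have h1 : Ctot ^ γ⁻¹ ≤ ((⌈Ctot ^ γ⁻¹⌉₊ + 2 : ℕ) : ℝ) := by
      push_cast
      linarith [Nat.le_ceil (Ctot ^ γ⁻¹)]
    calc Ctot = (Ctot ^ γ⁻¹) ^ γ := (Real.rpow_inv_rpow hCtot0 hγ0.ne').symm
      _ ≤ ((⌈Ctot ^ γ⁻¹⌉₊ + 2 : ℕ) : ℝ) ^ γ := Real.rpow_le_rpow h0 h1 hγ0.le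
  refine ⟨m, hm2, ?_⟩
  have hm0 : (0 : ℝ) < m := by exact_mod_cast (by omega : 0 < m)
  calc (tensorRank (matMulTensor ℤ m m m) : ℝ)
        ≤ Ctot * (m : ℝ) ^ (2 + δ) := glued m (by omega)
    _ ≤ (m : ℝ) ^ γ * (m : ℝ) ^ (2 + δ) :=
        mul_le_mul_of_nonneg_right hmC (Real.rpow_nonneg hm0.le _)
    _ = (m : ℝ) ^ (2 + ε) := by
        rw [← Real.rpow_add hm0]
        congr 1
        rw [hγ, hδ]
        ring

/-- **Closes item `stmt-MatrixMultiplication-18952` (`LocalToGlobal`)** of route `IntegralSignedBoxes`: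
`ModularExponentTwo → PadicLifting → IntegralExponentTwo`, by `IntegralExponentTwo_of_subs` (the item
bodies are definitionally its two hypotheses). -/
theorem localToGlobal_proof :
    Summit.MatrixMultiplication.MatrixMultiplication.Theses.IntegralSignedBoxes.LocalToGlobal :=
  fun h₁ h₂ => IntegralExponentTwo_of_subs h₁ h₂

/-- The same glue with the route decls BY NAME. -/
theorem integralExponentTwo_of_pieces (h₁ : ModularExponentTwo) (h₂ : PadicLifting) :
    IntegralExponentTwo :=
  localToGlobal_proof h₁ h₂

end Summit.MatrixMultiplication.MatrixMultiplication.Theorems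

end
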